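import Summits.ResolutionOfSingularities.KangarooAtlas.MizutaniOdaOperators
import Summits.ResolutionOfSingularities.KangarooAtlas.MizutaniInvFormsTensor
import Mathlib.LinearAlgebra.BilinearForm.Orthogonal
import Mathlib.LinearAlgebra.Matrix.ToLin
import HarnessLib

/-!
# Mizutani's Lemma 2.3: the duality `𝒥_e(U^⊥) = 𝒟_e(U)^⊥`, `𝒥_e(U)^⊥ = 𝒟_e(U^⊥)` through the tensor square

Cell `pub-rosobs`, Mizutani enclosure (seat mizutani-encloser-1, gen 9).  AI-written; *AI review is weaker than
expert review*; NOT a resolution-of-singularities theorem (summit relevance C).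

For the operators `dSpan k p e = 𝒟_e` and `jCore k p e = 𝒥_e` of `MizutaniOdaOperators.lean` (Mizutani 1973 §1 (b)) this
file gives the dictionary with the tensor square `k ⊗_{k^q} k`, `q = p^e`, `J` the diagonal ideal
(`MizutaniDiffDuality.mem_ideal_pow_iff_forall_dPair`: `ρ ∈ J^q ⟺` every operator of order `≤ q − 1` pairs `ρ` to `0`):

* `tens e a b = Σ_i a_i ⊗ b_i`; `forall_sum_apply_mul_eq_zero_iff` — `Σ_i D(a_i) b_i = 0` for all
  `D ∈ Diff_{q−1}(k/k^q)` iff `tens a b ∈ J^q`; the flip preserves `J^q` (`tens_mem_pow_comm`);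
* the dot-product orthogonal `orth U = U^⊥` on `k^{n+1}` (Mathlib's `BilinForm.orthogonal` of `dotProductBilin`;
  `orth_orth`, `finrank_orth`), `mem_jCore_orth_iff` (`a ∈ 𝒥_e(U^⊥) ⟺ tens a u ∈ J^q ∀ u ∈ U`), `mem_orth_dSpan_iff`
  (`b ∈ 𝒟_e(U)^⊥ ⟺ tens u b ∈ J^q ∀ u ∈ U`);
* **LEMMA 2.3** (Mizutani 1973 = Oda 1973 [O1] Lemma 2.8; Oda 1983-II Thm. 2.2 (2') ⟺ (3) ⟺ (3')):
  **`jCore_orth : 𝒥_e(U^⊥) = 𝒟_e(U)^⊥`** and **`orth_jCore : 𝒥_e(U)^⊥ = 𝒟_e(U^⊥)`**, with the corollaries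
  `dSpan_eq_orth_jCore_orth`, `jCore_eq_orth_dSpan_orth`, `mem_dSpan_iff`, **`mem_jCore_dSpan_iff`** (the closure
  `𝒥_e𝒟_e(V)` = all `a` with `Σ a_i ⊗ c_i ∈ J^q` whenever `Σ v_i ⊗ c_i ∈ J^q` for all `v ∈ V`) and
  **`mem_invForms_iff_tens`** (`a ∈ (L_B)_e(𝔭) ⟺ Σ a_i ⊗ b_i ∈ J^q` for every `b ⊥ V_e(𝔭)`; the coordinate-free form of
  `mem_invForms_iff_rho`).

## References

* H. Mizutani, *Hironaka's additive group schemes*, Nagoya Math. J. 52 (1973) 85–95: Def. 2.2, Lemma 2.3.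
  [Mizutani1973HironakaGroupSchemes]
* T. Oda, *Hironaka's additive group scheme, II*, Publ. RIMS 19 (1983): §1 (p. 1165), Thm. 2.2 (p. 1169–1171).
  [Oda1983HironakaGroupSchemeII]
-/

noncomputable section

open MvPolynomial TensorProduct Literature.AlgebraicGeometry.Resolution
  Literature.AlgebraicGeometry.Resolution.HironakaScheme

namespace Summit.ResolutionOfSingularities.KangarooAtlas.Mizutani

universe u

/-! ## The tensor dictionary and Lemma 2.3 -/

section Tensor

variable (k : Type u) [Field k] (p : ℕ) [hp : Fact p.Prime] [CharP k p] {n : ℕ} (e : ℕ)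

/-- `tens e a b = Σ_i a_i ⊗ b_i ∈ k ⊗_{k^{p^e}} k` — Oda's pairing `⟨v, v'⟩` of a vector of `k ⊗_{k^q} W` with a vector of
`k ⊗_{k^q} W^*`, in the coordinates `X_i^q` and their dual basis. [cite: Oda1983HironakaGroupSchemeII, Thm. 2.2 (3') (p. 1170)] -/
def tens (a b : Fin (n + 1) → k) : k ⊗[frobPow k p e] k := ∑ i, a i ⊗ₜ[frobPow k p e] b i

/-- `dPair D (tens a b) = Σ_i D(a_i) b_i`. [folklore] -/
theorem dPair_tens (D : k →ₗ[frobPow k p e] k) (a b : Fin (n + 1) → k) :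
    dPair (frobPow k p e) (AlgHom.id (frobPow k p e) k) D (tens k p e a b) = ∑ i, D (a i) * b i := by
  unfold tens
  rw [map_sum]
  exact Finset.sum_congr rfl fun i _ => by rw [dPair_tmul, AlgHom.id_apply]

/-- The flip exchanges the two arguments of `tens`. [folklore] -/
theorem comm_tens (a b : Fin (n + 1) → k) :
    Algebra.TensorProduct.comm (frobPow k p e) k k (tens k p e a b) = tens k p e b a := by
  unfold tens
  rw [map_sum]
  exact Finset.sum_congr rfl fun i _ => by rw [Algebra.TensorProduct.comm_tmul]

/-- `tens a b ∈ J^q ↔ tens b a ∈ J^q` (the flip preserves the powers of the diagonal ideal). [folklore] -/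
theorem tens_mem_pow_comm (a b : Fin (n + 1) → k) (m : ℕ) :
    tens k p e a b ∈ KaehlerDifferential.ideal (frobPow k p e) k ^ m ↔
      tens k p e b a ∈ KaehlerDifferential.ideal (frobPow k p e) k ^ m := by
  constructor
  · intro h
    rw [← comm_tens]
    exact comm_mem_ideal_pow (frobPow k p e) h
  · intro h
    rw [← comm_tens]
    exact comm_mem_ideal_pow (frobPow k p e) h

/-- **`Σ_i D(a_i) b_i = 0` for every `D ∈ Diff_{p^e−1}(k/k^{p^e})` iff `Σ a_i ⊗ b_i ∈ J^{p^e}`** (duality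
`mem_ideal_pow_iff_forall_dPair`). [cite: Oda1983HironakaGroupSchemeII, §1 (p. 1165) and Thm. 2.2 (proof, p. 1170)] -/
theorem forall_sum_apply_mul_eq_zero_iff (a b : Fin (n + 1) → k) :
    (∀ D : k →ₗ[frobPow k p e] k, IsDiffOpLE (frobPow k p e) (p ^ e - 1) D → ∑ i, D (a i) * b i = 0) ↔
      tens k p e a b ∈ KaehlerDifferential.ideal (frobPow k p e) k ^ p ^ e := by
  have hq : KaehlerDifferential.ideal (frobPow k p e) k ^ p ^ e =
      KaehlerDifferential.ideal (frobPow k p e) k ^ ((p ^ e - 1) + 1) := by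
    rw [← pow_eq_sub_one_add_one p e]
  rw [hq, mem_ideal_pow_iff_forall_dPair]
  refine forall_congr' fun D => forall_congr' fun _ => ?_
  rw [dPair_tens]

/-! ### The dot-product orthogonal -/

/-- `U^⊥` for the pairing `⟨a, b⟩ = Σ_i a_i b_i` on `k^{n+1}` (the pairing of `k ⊗_{k^q} W` with `k ⊗_{k^q} W^*` in the
coordinates `X_i^q` and their dual basis). [cite: Mizutani1973HironakaGroupSchemes, Def. 2.2 (W^* the dual space)] -/
def orth (U : Submodule k (Fin (n + 1) → k)) : Submodule k (Fin (n + 1) → k) :=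
  LinearMap.BilinForm.orthogonal (dotProductBilin k k) U

variable {e}

omit hp [CharP k p] in
/-- Membership in `U^⊥`. [folklore] -/
theorem mem_orth_iff {U : Submodule k (Fin (n + 1) → k)} {b : Fin (n + 1) → k} :
    b ∈ orth k U ↔ ∀ u ∈ U, ∑ i, u i * b i = 0 := by
  unfold orth
  rw [LinearMap.BilinForm.mem_orthogonal_iff]
  refine forall_congr' fun u => forall_congr' fun _ => ?_
  rw [dotProductBilin_apply_apply]
  rfl

omit hp [CharP k p] in
/-- The dot product is reflexive. [folklore] -/
theorem dotProductBilin_isRefl : LinearMap.BilinForm.IsRefl (dotProductBilin k k : LinearMap.BilinForm k (Fin (n + 1) → k)) := by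
  intro a b h
  rw [dotProductBilin_apply_apply] at h ⊢
  rwa [dotProduct_comm]

omit hp [CharP k p] in
/-- The dot product is nondegenerate. [folklore] -/
theorem dotProductBilin_nondegenerate :
    LinearMap.BilinForm.Nondegenerate (dotProductBilin k k : LinearMap.BilinForm k (Fin (n + 1) → k)) := by
  refine ⟨fun a h => ?_, fun a h => ?_⟩
  · funext i
    have := h (Pi.single i 1)
    rw [dotProductBilin_apply_apply, dotProduct_single, mul_one] at this
    rw [this, Pi.zero_apply]
  · funext i
    have := h (Pi.single i 1)
    rw [dotProductBilin_apply_apply, single_dotProduct, one_mul] at this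
    rw [this, Pi.zero_apply]

omit hp [CharP k p] in
/-- **`U^⊥⊥ = U`** (finite dimension). [folklore] -/
theorem orth_orth (U : Submodule k (Fin (n + 1) → k)) : orth k (orth k U) = U := by
  unfold orth
  exact LinearMap.BilinForm.orthogonal_orthogonal (dotProductBilin_nondegenerate k) (dotProductBilin_isRefl k) U

omit hp [CharP k p] in
/-- `U^⊥` is antitone. [folklore] -/
theorem orth_anti {U U' : Submodule k (Fin (n + 1) → k)} (h : U ≤ U') : orth k U' ≤ orth k U :=
  LinearMap.BilinForm.orthogonal_le h

omit hp [CharP k p] in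
/-- `dim U^⊥ = n + 1 − dim U`. [folklore] -/
theorem finrank_orth (U : Submodule k (Fin (n + 1) → k)) :
    Module.finrank k (orth k U) = n + 1 - Module.finrank k U := by
  unfold orth
  rw [LinearMap.BilinForm.finrank_orthogonal (dotProductBilin_nondegenerate k), Module.finrank_fintype_fun_eq_card,
    Fintype.card_fin]

omit hp [CharP k p] in
/-- `⊤^⊥ = ⊥`. [folklore] -/
theorem orth_top : orth k (⊤ : Submodule k (Fin (n + 1) → k)) = ⊥ := by
  rw [eq_bot_iff]
  intro b hb
  rw [Submodule.mem_bot]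
  exact (dotProductBilin_nondegenerate k).2 b fun a => by
    have := (mem_orth_iff k).mp hb a Submodule.mem_top
    rw [dotProductBilin_apply_apply]
    exact this

omit hp [CharP k p] in
/-- `⊥^⊥ = ⊤`. [folklore] -/
theorem orth_bot : orth k (⊥ : Submodule k (Fin (n + 1) → k)) = ⊤ := by
  rw [← orth_top k, orth_orth]

omit hp [CharP k p] in
/-- `U^⊥ = ⊤ ↔ U = ⊥`. [folklore] -/
theorem orth_eq_top_iff {U : Submodule k (Fin (n + 1) → k)} : orth k U = ⊤ ↔ U = ⊥ := by
  constructor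
  · intro h
    rw [← orth_orth k U, h, orth_top]
  · rintro rfl
    exact orth_bot k

omit hp [CharP k p] in
/-- `U^⊥ = ⊥ ↔ U = ⊤`. [folklore] -/
theorem orth_eq_bot_iff {U : Submodule k (Fin (n + 1) → k)} : orth k U = ⊥ ↔ U = ⊤ := by
  constructor
  · intro h
    rw [← orth_orth k U, h, orth_bot]
  · rintro rfl
    exact orth_top k

omit hp [CharP k p] in
/-- `orth` is injective. [folklore] -/
theorem orth_injective {U U' : Submodule k (Fin (n + 1) → k)} (h : orth k U = orth k U') : U = U' := by
  rw [← orth_orth k U, h, orth_orth]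

/-! ### `𝒥_e` and `𝒟_e` through the tensor square -/

/-- **`a ∈ 𝒥_e(U^⊥) ↔ Σ a_i ⊗ u_i ∈ J^{p^e}` for all `u ∈ U`.** [cite: Oda1983HironakaGroupSchemeII, Thm. 2.2 (2') ⟺ (3') (p. 1170–1171)] -/
theorem mem_jCore_orth_iff {U : Submodule k (Fin (n + 1) → k)} {a : Fin (n + 1) → k} :
    a ∈ jCore k p e (orth k U) ↔ ∀ u ∈ U, tens k p e a u ∈ KaehlerDifferential.ideal (frobPow k p e) k ^ p ^ e := by
  rw [mem_jCore_iff]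
  simp_rw [mem_orth_iff]
  constructor
  · intro h u hu
    rw [← forall_sum_apply_mul_eq_zero_iff]
    intro D hD
    have := h D hD u hu
    simpa [mul_comm] using this
  · intro h D hD u hu
    have := (forall_sum_apply_mul_eq_zero_iff k p e a u).mpr (h u hu) D hD
    simpa [mul_comm] using this

/-- **`b ∈ 𝒟_e(U)^⊥ ↔ Σ u_i ⊗ b_i ∈ J^{p^e}` for all `u ∈ U`.** [cite: Oda1983HironakaGroupSchemeII, Thm. 2.2 (3) (p. 1170)] -/
theorem mem_orth_dSpan_iff {U : Submodule k (Fin (n + 1) → k)} {b : Fin (n + 1) → k} :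
    b ∈ orth k (dSpan k p e U) ↔ ∀ u ∈ U, tens k p e u b ∈ KaehlerDifferential.ideal (frobPow k p e) k ^ p ^ e := by
  constructor
  · intro h u hu
    rw [← forall_sum_apply_mul_eq_zero_iff]
    intro D hD
    exact (mem_orth_iff k).mp h _ (apply_mem_dSpan k p hu hD)
  · intro h
    -- `{w : Σ w_i b_i = 0}` is a subspace containing the generators of `𝒟_e(U)`
    have hle : dSpan k p e U ≤ orth k (k ∙ b) := by
      unfold dSpan
      rw [Submodule.span_le]
      rintro _ ⟨u, hu, D, hD, rfl⟩
      rw [SetLike.mem_coe, mem_orth_iff]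
      intro c hc
      obtain ⟨t, rfl⟩ := Submodule.mem_span_singleton.mp hc
      have h0 := (forall_sum_apply_mul_eq_zero_iff k p e u b).mpr (h u hu) D hD
      simp only [Pi.smul_apply, smul_eq_mul]
      calc ∑ i, t * b i * D (u i) = t * ∑ i, D (u i) * b i := by
            rw [Finset.mul_sum]; exact Finset.sum_congr rfl fun i _ => by ring
        _ = 0 := by rw [h0, mul_zero]
    rw [mem_orth_iff]
    intro w hw
    have := (mem_orth_iff k).mp (hle hw) b (Submodule.mem_span_singleton_self b)
    simpa [mul_comm] using this

variable (e)

/-- **LEMMA 2.3 (Oda 1973 Lemma 2.8), first form: `𝒥_e(U^⊥) = 𝒟_e(U)^⊥`.**  Both sides are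
`{a : Σ a_i ⊗ u_i ∈ J^q ∀ u ∈ U}` up to the flip `x ⊗ y ↦ y ⊗ x`, which preserves `J^q`.
[cite: Mizutani1973HironakaGroupSchemes, Lemma 2.3 (𝒟_e(U)^⊥ = 𝒥_e(U^⊥))] -/
theorem jCore_orth (U : Submodule k (Fin (n + 1) → k)) : jCore k p e (orth k U) = orth k (dSpan k p e U) := by
  ext a
  rw [mem_jCore_orth_iff, mem_orth_dSpan_iff]
  refine forall_congr' fun u => forall_congr' fun _ => ?_
  exact tens_mem_pow_comm k p e a u _

/-- **LEMMA 2.3, second form: `𝒥_e(U)^⊥ = 𝒟_e(U^⊥)`** (from the first by bi-orthogonality).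
[cite: Mizutani1973HironakaGroupSchemes, Lemma 2.3 (𝒥_e(U)^⊥ = 𝒟_e(U^⊥))] -/
theorem orth_jCore (U : Submodule k (Fin (n + 1) → k)) : orth k (jCore k p e U) = dSpan k p e (orth k U) := by
  have h := jCore_orth k p e (orth k U)
  rw [orth_orth] at h
  rw [h, orth_orth]

/-- `𝒟_e(V) = (𝒥_e(V^⊥))^⊥`: the hull in terms of the core. [cite: Mizutani1973HironakaGroupSchemes, Lemma 2.3] -/
theorem dSpan_eq_orth_jCore_orth (V : Submodule k (Fin (n + 1) → k)) :
    dSpan k p e V = orth k (jCore k p e (orth k V)) := by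
  rw [jCore_orth, orth_orth]

/-- `𝒥_e(U) = (𝒟_e(U^⊥))^⊥`. [cite: Mizutani1973HironakaGroupSchemes, Lemma 2.3] -/
theorem jCore_eq_orth_dSpan_orth (U : Submodule k (Fin (n + 1) → k)) :
    jCore k p e U = orth k (dSpan k p e (orth k U)) := by
  rw [← jCore_orth, orth_orth]

/-- `b ∈ 𝒟_e(V) ↔ Σ a_i ⊗ b_i ∈ J^q` for every `a ∈ 𝒥_e(V^⊥)` — i.e. for every `a` with `Σ a_i ⊗ c_i ∈ J^q ∀ c ∈ V^⊥`…;
in the handier form: `b ∈ 𝒟_e(V)` iff `b ⊥ c` for every `c` with `Σ v_i ⊗ c_i ∈ J^q` for all `v ∈ V`.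
[cite: Oda1983HironakaGroupSchemeII, Thm. 2.2 (3)] -/
theorem mem_dSpan_iff (V : Submodule k (Fin (n + 1) → k)) (b : Fin (n + 1) → k) :
    b ∈ dSpan k p e V ↔ ∀ c : Fin (n + 1) → k,
      (∀ v ∈ V, tens k p e v c ∈ KaehlerDifferential.ideal (frobPow k p e) k ^ p ^ e) → ∑ i, c i * b i = 0 := by
  rw [← orth_orth k (dSpan k p e V), mem_orth_iff]
  refine ⟨fun h c hc => h c ((mem_orth_dSpan_iff k p).mpr hc), fun h c hc => h c ((mem_orth_dSpan_iff k p).mp hc)⟩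

/-- **The closure `𝒥_e𝒟_e` in tensor form**: `a ∈ 𝒥_e(𝒟_e(V))` iff `Σ a_i ⊗ c_i ∈ J^q` for every `c` such that
`Σ v_i ⊗ c_i ∈ J^q` for all `v ∈ V`. [cite: Mizutani1973HironakaGroupSchemes, Thm. 1.3 with Lemma 2.3] -/
theorem mem_jCore_dSpan_iff (V : Submodule k (Fin (n + 1) → k)) (a : Fin (n + 1) → k) :
    a ∈ jCore k p e (dSpan k p e V) ↔ ∀ c : Fin (n + 1) → k,
      (∀ v ∈ V, tens k p e v c ∈ KaehlerDifferential.ideal (frobPow k p e) k ^ p ^ e) →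
        tens k p e a c ∈ KaehlerDifferential.ideal (frobPow k p e) k ^ p ^ e := by
  rw [← orth_orth k (dSpan k p e V), mem_jCore_orth_iff]
  refine ⟨fun h c hc => h c ((mem_orth_dSpan_iff k p).mpr hc), fun h c hc => h c ((mem_orth_dSpan_iff k p).mp hc)⟩

/-- **Invariant forms in tensor form, intrinsically**: `a ∈ (L_B)_e(𝔭)` iff `Σ a_i ⊗ b_i ∈ J^{p^e}` for every
`b ∈ V_e(𝔭)^⊥` (compare `mem_invForms_iff_rho`, the same in the coordinates `c_{ij}`, whose columns span `V_e(𝔭)^⊥`).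
[cite: Oda1983HironakaGroupSchemeII, Cor. 2.3 (V = 𝒥'(U)) and Thm. 2.2 (3')] -/
theorem mem_invForms_iff_tens (𝔭 : Ideal (MvPolynomial (Fin (n + 1)) k)) (a : Fin (n + 1) → k) :
    a ∈ invForms k p 𝔭 e ↔
      ∀ b ∈ orth k (pointForms k p 𝔭 e), tens k p e a b ∈ KaehlerDifferential.ideal (frobPow k p e) k ^ p ^ e := by
  rw [invForms_eq_jCore_pointForms, ← orth_orth k (pointForms k p 𝔭 e), mem_jCore_orth_iff, orth_orth]

end Tensor

end Summit.ResolutionOfSingularities.KangarooAtlas.Mizutani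

end
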